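import Mathlib.Analysis.SpecialFunctions.Exp
import Mathlib.Computability.Partrec
import Mathlib.Data.Rat.Denumerable
import Literature.Computability.Complexity.ComputableReal
import HarnessLib

/-!
# The complex exponential is computable along computable sequences (named fact, Weihrauch 2000)

One published-but-unformalised result of computable analysis, vendored as a NAMED FACT (D-0014,
CONVENTIONS §4), in the fast-Cauchy-name dress of route `Schanuel/ArithmeticalComplexity`
(uniform Gaussian-rational names `f : ℕ × ℕ → ℚ × ℚ`, `‖a k − f(k,m)‖ ≤ 2⁻ᵐ`; pointwise this is the
convention of `Literature.Computability.Complexity.IsComputableReal` / `IsComputableComplex` in this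
directory):

* `uniformlyComputable_cexp` — if `a : ℕ → ℂ` is a computable SEQUENCE of complex numbers (one
  computable name `f (k, m)` for all `k`), then so is `k ↦ exp (a k)`
  [Weihrauch 2000, Example 4.3.13.2: "the exponential function is computable on `ℂ`" (a single
  Type-2 machine, via the power-series Theorem 4.3.12.2 with `r_k = k + 1`, `M_k = r_k^{r_k}`),
  with Theorem 4.3.10 / Lemma 4.3.6.1: a computable function maps computable sequences to
  computable sequences (`(x_i)_i ↦ (f x_i)_i` is `([ρ]^ω,[ρ]^ω)`-computable), transcribed from
  Weihrauch's Cauchy representation `ρ_C` (Def. 4.1.5, Lemma 4.1.6) to dyadic-rate Gaussian-rational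
  names, a computably equivalent naming system (shift by one index)].

The pointwise corollary "`exp` of a computable complex number is computable" is NOT filed as a
second fact (it follows from the uniform one applied to a constant sequence, D-0026); a consumer
needing it should prove it next to its use.

Purpose. Grounds the numerical half of
`Summit.Schanuel.Schanuel.Theses.ArithmeticalComplexity.SchanuelPi03` (item stmt-Schanuel-4030):
to see that "`P(a(l), e^{a(l)}) ≠ 0`" is `Σ⁰₁` along a uniformly computable sequence `a` one needs
uniformly computable names for `e^{a k}`; the arithmetic on names (Thm 4.3.9: `+`, `·`, integer
polynomials) is elementary, the exponential is this fact. Not needed by the items that assume an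
exact zero test (4031, 4032). Mathlib has `Computable`, `Primcodable ℚ` (via `Denumerable ℚ`) but no
computable analysis; the tree has the pointwise real notions (`IsComputableReal.add/neg/mul`,
discharged in `ComputableRealProofs.lean`) and nothing on `exp`.

## References

* K. Weihrauch, *Computable Analysis. An Introduction*, Texts in Theoretical Computer Science,
  Springer (2000): Def. 4.1.5 / Lemma 4.1.6 (Cauchy representation), Thm 4.3.9 (computable complex
  field operations and polynomials), Thm 4.3.10 and Lemma 4.3.6 (sequences), Thm 4.3.12 (power
  series), Example 4.3.13.2 (`exp` on `ℂ`), Example 4.3.13.3 (`sin`, `cos`).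
  [WeihrauchComputableAnalysis2000] (the tree's interim stub key for the same book is Weihrauch2000)

## Design notes

* Statement only (`def … : Prop`); no `sorry`. Discharge = `theorem uniformlyComputable_cexp_holds`.
* Names are Gaussian rationals `ℚ × ℚ` read as `q.1 + q.2 i`, error `≤ 1 / 2 ^ m` in the complex
  norm — verbatim the convention of the Schanuel route items, so that the uniform fact applies to
  their hypothesis `∃ f : ℕ × ℕ → ℚ × ℚ, Computable f ∧ ∀ k m, ‖a k - …‖ ≤ 1 / 2 ^ m` by `obtain`.
-/

noncomputable section

namespace Literature.Computability.Complexity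

/-- **The complex exponential acts on computable sequences** (named fact): if `a : ℕ → ℂ` has ONE
computable Gaussian-rational name `f : ℕ × ℕ → ℚ × ℚ` with `‖a k − (f(k,m).1 + f(k,m).2 i)‖ ≤ 2⁻ᵐ`
for all `k m`, then `k ↦ exp (a k)` has such a name too. Weihrauch 2000, Example 4.3.13.2 (`exp`
is computable on `ℂ` by a single machine) with Theorem 4.3.10 / Lemma 4.3.6.1 (a computable
function maps computable sequences of (complex) numbers to computable sequences), read through
the Cauchy representation (Def. 4.1.5, Lemma 4.1.6, Lemma 4.2.1). Grounds the numerical side of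
`Summit.Schanuel.Schanuel.Theses.ArithmeticalComplexity.SchanuelPi03` (stmt-Schanuel-4030), whose
hypothesis on `a` is literally the antecedent below. [cite: WeihrauchComputableAnalysis2000, Example 4.3.13.2] -/
def uniformlyComputable_cexp : Prop :=
  ∀ a : ℕ → ℂ,
    (∃ f : ℕ × ℕ → ℚ × ℚ, Computable f ∧
      ∀ k m : ℕ, ‖a k - (((f (k, m)).1 : ℂ) + ((f (k, m)).2 : ℂ) * Complex.I)‖ ≤ 1 / 2 ^ m) →
    ∃ g : ℕ × ℕ → ℚ × ℚ, Computable g ∧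
      ∀ k m : ℕ, ‖Complex.exp (a k) - (((g (k, m)).1 : ℂ) + ((g (k, m)).2 : ℂ) * Complex.I)‖ ≤ 1 / 2 ^ m

/-- Sanity: the constant sequence `0` has the computable name `(k, m) ↦ (0, 0)`, so the uniform
fact yields a computable name of the constant sequence `exp 0 = 1` (a consistency check of the
quantifier shape, not a discharge). [folklore] -/
example (h : uniformlyComputable_cexp) :
    ∃ g : ℕ × ℕ → ℚ × ℚ, Computable g ∧
      ∀ k m : ℕ, ‖Complex.exp ((fun _ : ℕ => (0 : ℂ)) k) -
        (((g (k, m)).1 : ℂ) + ((g (k, m)).2 : ℂ) * Complex.I)‖ ≤ 1 / 2 ^ m := by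
  refine h (fun _ => 0) ⟨fun _ => (0, 0), Computable.const _, fun k m => ?_⟩
  simp

end Literature.Computability.Complexity
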